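import Summits.Ventures.PercRepro.C041TriangleTypeFamily2
import Summits.Ventures.PercRepro.C041TriangleTypeFamily3
import Summits.Ventures.PercRepro.C041CycleRelaxed

/-!
# THE MIXED FAMILY `X(p,0) × X(p′,q′)` IS IN THE CONE — and with it EVERY PAIR OF MARKED VERTICES
(mine-3, gen 60; C-041.md §21 (af))

The last open family of the marked-vertex cone conjecture (C-041.md §21 (ae)): one exit carries `p ≥ 1` marks of type 1
(`X(p, 0) = v 1 ^ p = (1, 2^p, 1, 0, 1, 0)`), the other a doubly-marked vertex `X(p′, q′) = (1, 2^p′, 2^q′, 0, 0, 0)`,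
`p′, q′ ≥ 1`.  Writing `A = 2^p`, `A′ = 2^p′`, `B′ = 2^q′`, the output is bilinear in `A` and `(A′, B′)`, and an exact
LP over polynomial coefficients in the shifted variables `A − 2, A′ − 2, B′ − 2` (mining/mine-3/tools/g60/mixedlp2.py)
gives the parametrised certificate on the atoms `{0, 1, ½, ⅓, ⅔}`
  `θ_△(X(p,0), X(p′,q′)) = (9/2)·v 1 * v ⅓ + (4A − 4)·v 1 * v ½ + ((A − 2)(B′ − 2) + 1)·X(1,1) + 9·v ⅔
     + (2A′ − 7/2)·v 1 + v 0 + (2AA′ − 2A − A′ − 2)·X(2,0) + (4B′ − 8)·v 0 * v ½`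
— a polynomial identity of six-vectors (`thetaTri_mixed`; at `p = p′ = q′ = 1` it is exactly the `X(1,1) × X(1,0)`
certificate of C041TriangleMarksCone), every coefficient non-negative for `A, A′, B′ ≥ 2`
(`2AA′ − 2A − A′ − 2 = 2(A − 2)(A′ − 2) + 2(A − 2) + 3(A′ − 2)`); its mirror under the type swap
(`v a ↔ v (1 − a)`) is the family `X(0,q) × X(p′,q′)` (`thetaTri_mixed'`).  THEOREM (`InCone_thetaTri_mixed`,
`InCone_thetaTri_mixed'`): both mixed families lie in the cone.  With the apex lemma in cone form
(`InCone_thetaTri_one`: `θ_△(w, 1) = 3ℓψ(w) + 2w`), the one-type pairs (`α = β`), the opposite-type family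
(`InCone_thetaTri_type_pair`) and the doubly-marked family (`InCone_thetaTri_doubly_marked`):
**THEOREM (`InCone_thetaTri_marks`): for ALL `p, q, p′, q′ ≥ 0` the triangle with `X(p,q)` and `X(p′,q′)` at its exits
lies in the cone**, and (`InCone_thetaCyc_marks_all`, `InCone_thetaCyc_marks_lengths`) so does EVERY two-exit cycle
through the anchor carrying two marked vertices with arbitrary marks — CONJECTURE (CONE) for the cycles with two marked
vertices (C-041.md §19 (i), §20 (c)) is a kernel theorem on the arc-type model.
-/

namespace PercRepro

namespace RelaxedTriangle

open TreeClosure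

/-! ## The mixed family `X(p,0) × X(p′,q′)` -/

/-- **THE MIXED IDENTITY** (`A = 2^p`, `A′ = 2^p′`, `B′ = 2^q′`, all exponents `≥ 1`). -/
theorem thetaTri_mixed (p p' q' : ℕ) (hp : 1 ≤ p) (hp' : 1 ≤ p') (hq' : 1 ≤ q') :
    thetaTri (v 1 ^ p) (v 1 ^ p' * v 0 ^ q') =
      (9 / 2 : ℝ) • (v 1 * v (1 / 3))
      + (4 * (2 : ℝ) ^ p - 4) • (v 1 * v (1 / 2))
      + (((2 : ℝ) ^ p - 2) * ((2 : ℝ) ^ q' - 2) + 1) • (v 1 * v 0)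
      + (9 : ℝ) • v (2 / 3)
      + (2 * (2 : ℝ) ^ p' - 7 / 2) • v 1
      + v 0
      + (2 * (2 : ℝ) ^ p * (2 : ℝ) ^ p' - 2 * (2 : ℝ) ^ p - (2 : ℝ) ^ p' - 2) • (v 1 * v 1)
      + (4 * (2 : ℝ) ^ q' - 8) • (v 0 * v (1 / 2)) := by
  rw [pow_v_one_eq p hp, pow_v_one_mul_pow_v_zero_eq p' q' hp' hq']
  ext i
  simp only [thetaTri_eq_vec, Pi.add_apply, Pi.smul_apply, Pi.mul_apply, smul_eq_mul, v]
  fin_cases i <;> simp <;> ring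

/-- **THE MIRRORED MIXED IDENTITY** for `X(0,q) × X(p′,q′)` (`B = 2^q`; the type swap `v a ↔ v (1 − a)`). -/
theorem thetaTri_mixed' (q p' q' : ℕ) (hq : 1 ≤ q) (hp' : 1 ≤ p') (hq' : 1 ≤ q') :
    thetaTri (v 0 ^ q) (v 1 ^ p' * v 0 ^ q') =
      (9 / 2 : ℝ) • (v 0 * v (2 / 3))
      + (4 * (2 : ℝ) ^ q - 4) • (v 0 * v (1 / 2))
      + (((2 : ℝ) ^ q - 2) * ((2 : ℝ) ^ p' - 2) + 1) • (v 1 * v 0)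
      + (9 : ℝ) • v (1 / 3)
      + (2 * (2 : ℝ) ^ q' - 7 / 2) • v 0
      + v 1
      + (2 * (2 : ℝ) ^ q * (2 : ℝ) ^ q' - 2 * (2 : ℝ) ^ q - (2 : ℝ) ^ q' - 2) • (v 0 * v 0)
      + (4 * (2 : ℝ) ^ p' - 8) • (v 1 * v (1 / 2)) := by
  rw [pow_v_zero_eq q hq, pow_v_one_mul_pow_v_zero_eq p' q' hp' hq']
  ext i
  simp only [thetaTri_eq_vec, Pi.add_apply, Pi.smul_apply, Pi.mul_apply, smul_eq_mul, v]
  fin_cases i <;> simp <;> ring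

/-- The fugacity-⅓ leaf lies in the cone. -/
theorem InCone_v_third : InCone (v (1 / 3)) := InCone_v (1 / 3) ⟨by norm_num, by norm_num⟩

/-- The fugacity-⅔ leaf lies in the cone. -/
theorem InCone_v_twothirds : InCone (v (2 / 3)) := InCone_v (2 / 3) ⟨by norm_num, by norm_num⟩

/-- **THEOREM (TRIANGLE, mixed pair `X(p,0) × X(p′,q′)`)**: for all `p, p′, q′ ≥ 1` the triangle lies in the cone. -/
theorem InCone_thetaTri_mixed (p p' q' : ℕ) (hp : 1 ≤ p) (hp' : 1 ≤ p') (hq' : 1 ≤ q') :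
    InCone (thetaTri (v 1 ^ p) (v 1 ^ p' * v 0 ^ q')) := by
  rw [thetaTri_mixed p p' q' hp hp' hq']
  have hA := two_le_two_pow p hp
  have hA' := two_le_two_pow p' hp'
  have hB' := two_le_two_pow q' hq'
  have c1 : (0 : ℝ) ≤ 4 * (2 : ℝ) ^ p - 4 := by linarith
  have c2 : (0 : ℝ) ≤ ((2 : ℝ) ^ p - 2) * ((2 : ℝ) ^ q' - 2) + 1 := by
    nlinarith [mul_nonneg (sub_nonneg.2 hA) (sub_nonneg.2 hB')]
  have c3 : (0 : ℝ) ≤ 2 * (2 : ℝ) ^ p' - 7 / 2 := by linarith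
  have c4 : (0 : ℝ) ≤ 2 * (2 : ℝ) ^ p * (2 : ℝ) ^ p' - 2 * (2 : ℝ) ^ p - (2 : ℝ) ^ p' - 2 := by
    nlinarith [mul_nonneg (sub_nonneg.2 hA) (sub_nonneg.2 hA')]
  have c5 : (0 : ℝ) ≤ 4 * (2 : ℝ) ^ q' - 8 := by linarith
  exact (((((((InCone.smul _ (by norm_num) (InCone_v1.mul InCone_v_third)).add
    (InCone.smul _ c1 (InCone_v1.mul InCone_vh))).add
    (InCone.smul _ c2 InCone_X11)).add
    (InCone.smul _ (by norm_num) InCone_v_twothirds)).add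
    (InCone.smul _ c3 InCone_v1)).add InCone_v0).add
    (InCone.smul _ c4 (InCone_v1.mul InCone_v1))).add
    (InCone.smul _ c5 (InCone_v0.mul InCone_vh))

/-- **THEOREM (TRIANGLE, mixed pair `X(0,q) × X(p′,q′)`)**: for all `q, p′, q′ ≥ 1` the triangle lies in the cone. -/
theorem InCone_thetaTri_mixed' (q p' q' : ℕ) (hq : 1 ≤ q) (hp' : 1 ≤ p') (hq' : 1 ≤ q') :
    InCone (thetaTri (v 0 ^ q) (v 1 ^ p' * v 0 ^ q')) := by
  rw [thetaTri_mixed' q p' q' hq hp' hq']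
  have hB := two_le_two_pow q hq
  have hA' := two_le_two_pow p' hp'
  have hB' := two_le_two_pow q' hq'
  have c1 : (0 : ℝ) ≤ 4 * (2 : ℝ) ^ q - 4 := by linarith
  have c2 : (0 : ℝ) ≤ ((2 : ℝ) ^ q - 2) * ((2 : ℝ) ^ p' - 2) + 1 := by
    nlinarith [mul_nonneg (sub_nonneg.2 hB) (sub_nonneg.2 hA')]
  have c3 : (0 : ℝ) ≤ 2 * (2 : ℝ) ^ q' - 7 / 2 := by linarith
  have c4 : (0 : ℝ) ≤ 2 * (2 : ℝ) ^ q * (2 : ℝ) ^ q' - 2 * (2 : ℝ) ^ q - (2 : ℝ) ^ q' - 2 := by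
    nlinarith [mul_nonneg (sub_nonneg.2 hB) (sub_nonneg.2 hB')]
  have c5 : (0 : ℝ) ≤ 4 * (2 : ℝ) ^ p' - 8 := by linarith
  exact (((((((InCone.smul _ (by norm_num) (InCone_v0.mul InCone_v_twothirds)).add
    (InCone.smul _ c1 (InCone_v0.mul InCone_vh))).add
    (InCone.smul _ c2 InCone_X11)).add
    (InCone.smul _ (by norm_num) InCone_v_third)).add
    (InCone.smul _ c3 InCone_v0)).add InCone_v1).add
    (InCone.smul _ c4 (InCone_v0.mul InCone_v0))).add
    (InCone.smul _ c5 (InCone_v1.mul InCone_vh))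

/-! ## The apex in cone form -/

/-- The triangle with the apex `1` (an unmarked vertex) at one exit: `θ_△(w, 1) = 3ℓψ(w) + 2w`. -/
theorem thetaTri_one_eq (w : Vec6) : thetaTri w 1 = (3 : ℝ) • ellv w + (2 : ℝ) • w := by
  ext i
  simp only [thetaTri_eq_vec, ellv, ell, Pi.add_apply, Pi.smul_apply, Pi.one_apply, smul_eq_mul]
  fin_cases i <;> simp <;> ring

/-- The apex lemma in cone form: the triangle with a cone member at one exit and an unmarked vertex at the other lies
in the cone. -/
theorem InCone_thetaTri_one {w : Vec6} (hw : InCone w) : InCone (thetaTri w 1) := by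
  rw [thetaTri_one_eq]
  exact (InCone.smul 3 (by norm_num) (InCone_ellv hw)).add (InCone.smul 2 (by norm_num) hw)

/-! ## Every pair of marked vertices -/

/-- `X(p,0)` (`p ≥ 1`) against an arbitrary marked vertex `X(p′,q′)`. -/
theorem InCone_thetaTri_pow_one_marks (p p' q' : ℕ) (hp : 1 ≤ p) :
    InCone (thetaTri (v 1 ^ p) (v 1 ^ p' * v 0 ^ q')) := by
  by_cases hp' : p' = 0
  · subst hp'
    by_cases hq' : q' = 0
    · subst hq'
      simp only [pow_zero, mul_one]
      exact InCone_thetaTri_one (InCone_pow_v_one p)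
    · simp only [pow_zero, one_mul]
      exact InCone_thetaTri_type_pair p q' hp (Nat.one_le_iff_ne_zero.mpr hq')
  · have hp'1 : 1 ≤ p' := Nat.one_le_iff_ne_zero.mpr hp'
    by_cases hq' : q' = 0
    · subst hq'
      simp only [pow_zero, mul_one]
      exact thetaTri_pow_one_InCone p p'
    · exact InCone_thetaTri_mixed p p' q' hp hp'1 (Nat.one_le_iff_ne_zero.mpr hq')

/-- `X(0,q)` (`q ≥ 1`) against an arbitrary marked vertex `X(p′,q′)`. -/
theorem InCone_thetaTri_pow_zero_marks (q p' q' : ℕ) (hq : 1 ≤ q) :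
    InCone (thetaTri (v 0 ^ q) (v 1 ^ p' * v 0 ^ q')) := by
  by_cases hp' : p' = 0
  · subst hp'
    by_cases hq' : q' = 0
    · subst hq'
      simp only [pow_zero, mul_one]
      exact InCone_thetaTri_one (InCone_pow_v_zero q)
    · simp only [pow_zero, one_mul]
      exact thetaTri_pow_zero_InCone q q'
  · have hp'1 : 1 ≤ p' := Nat.one_le_iff_ne_zero.mpr hp'
    by_cases hq' : q' = 0
    · subst hq'
      simp only [pow_zero, mul_one]
      rw [thetaTri_comm]
      exact InCone_thetaTri_type_pair p' q hp'1 hq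
    · exact InCone_thetaTri_mixed' q p' q' hq hp'1 (Nat.one_le_iff_ne_zero.mpr hq')

/-- **THEOREM (TRIANGLE, ALL PAIRS OF MARKED VERTICES)**: for ALL `p, q, p′, q′ ≥ 0` the triangle with the marked
vertices `X(p,q) = v 1 ^ p * v 0 ^ q` and `X(p′,q′)` at its exits lies in the cone — CONJECTURE (CONE) of C-041.md
§19 (i) / §20 (c) for the triangle with two single marked vertices, in full generality. -/
theorem InCone_thetaTri_marks (p q p' q' : ℕ) :
    InCone (thetaTri (v 1 ^ p * v 0 ^ q) (v 1 ^ p' * v 0 ^ q')) := by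
  by_cases hp : p = 0
  · subst hp
    by_cases hq : q = 0
    · subst hq
      simp only [pow_zero, mul_one]
      rw [thetaTri_comm]
      exact InCone_thetaTri_one ((InCone_pow_v_one p').mul (InCone_pow_v_zero q'))
    · simp only [pow_zero, one_mul]
      exact InCone_thetaTri_pow_zero_marks q p' q' (Nat.one_le_iff_ne_zero.mpr hq)
  · have hp1 : 1 ≤ p := Nat.one_le_iff_ne_zero.mpr hp
    by_cases hq : q = 0
    · subst hq
      simp only [pow_zero, mul_one]
      exact InCone_thetaTri_pow_one_marks p p' q' hp1
    · have hq1 : 1 ≤ q := Nat.one_le_iff_ne_zero.mpr hq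
      by_cases hp' : p' = 0
      · subst hp'
        by_cases hq' : q' = 0
        · subst hq'
          simp only [pow_zero, mul_one]
          exact InCone_thetaTri_one ((InCone_pow_v_one p).mul (InCone_pow_v_zero q))
        · simp only [pow_zero, one_mul]
          rw [thetaTri_comm]
          exact InCone_thetaTri_mixed' q' p q (Nat.one_le_iff_ne_zero.mpr hq') hp1 hq1
      · have hp'1 : 1 ≤ p' := Nat.one_le_iff_ne_zero.mpr hp'
        by_cases hq' : q' = 0
        · subst hq'
          simp only [pow_zero, mul_one]
          rw [thetaTri_comm]
          exact InCone_thetaTri_mixed p' p q hp'1 hp1 hq1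
        · exact InCone_thetaTri_doubly_marked p q p' q' hp1 hq1 hp'1 (Nat.one_le_iff_ne_zero.mpr hq')

/-- **THEOREM (CYCLES WITH TWO MARKED VERTICES, cone form)**: every two-exit cycle through the anchor carrying two
marked vertices with arbitrary marks lies in the cone (arc-type model, any multiplicities `p, q, s ≥ 0`). -/
theorem InCone_thetaCyc_marks_all (p₀ q₀ p₁ q₁ : ℕ) {p q s : ℝ} (hp : 0 ≤ p) (hq : 0 ≤ q) (hs : 0 ≤ s) :
    InCone (thetaCyc p q s (v 1 ^ p₀ * v 0 ^ q₀) (v 1 ^ p₁ * v 0 ^ q₁)) :=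
  InCone_thetaCyc_of_InCone_tri ((InCone_pow_v_one p₀).mul (InCone_pow_v_zero q₀))
    ((InCone_pow_v_one p₁).mul (InCone_pow_v_zero q₁)) (InCone_thetaTri_marks p₀ q₀ p₁ q₁) hp hq hs

/-- The same for actual cycles: arcs of lengths `l₁, l₂, l₃ ≥ 1` (cycle length `m = l₁ + l₂ + l₃ ≥ 3`, the marked
vertices at positions `l₁` and `l₁ + l₂`), mixed multiplicities `2^l − 2`. -/
theorem InCone_thetaCyc_marks_lengths (p₀ q₀ p₁ q₁ l₁ l₂ l₃ : ℕ) (h₁ : 1 ≤ l₁) (h₂ : 1 ≤ l₂) (h₃ : 1 ≤ l₃) :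
    InCone (thetaCyc ((2 : ℝ) ^ l₁ - 2) ((2 : ℝ) ^ l₂ - 2) ((2 : ℝ) ^ l₃ - 2)
      (v 1 ^ p₀ * v 0 ^ q₀) (v 1 ^ p₁ * v 0 ^ q₁)) :=
  InCone_thetaCyc_marks_all p₀ q₀ p₁ q₁ (mixed_mult_nonneg l₁ h₁) (mixed_mult_nonneg l₂ h₂)
    (mixed_mult_nonneg l₃ h₃)

end RelaxedTriangle

end PercRepro
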